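import Mathlib
import Summits.Schanuel.Schanuel.Theses.SingularModulusScaling
import Summits.Schanuel.Schanuel.Theorems.RigidCoreSchanuelOnLogFreeCoreSectorGlue
import Summits.Schanuel.Schanuel.Theorems.RigidCoreSchanuelOnLogFreeCoreSectorExactness
import Literature.NumberTheory.Transcendental.LindemannWeierstrassProofs
import Literature.NumberTheory.Transcendental.GelfondExpLogConjectureProofs
import Literature.NumberTheory.Transcendental.KirbyWeakSchanuelAx
import Literature.NumberTheory.Transcendental.ExpAlgebraicNumbersProofs

/-!
# Strategist calibration of crux `RelSchanuelOverPiLWField` (stmt-Schanuel-9548), r1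

Redirect-strategist evidence (unit `cstrat-stmt-Schanuel-9548-r1`), all sorry-free.  The crux
`C := RelSchanuelOverPiLWField` is Schanuel's count RELATIVE to the π–LW field
`K₂ = ℚ(ℚ̄ ∪ {πi} ∪ e^{ℚ̄})` for tuples `ℚ`-free modulo `E₂ = span_ℚ(ℚ̄ ∪ {πi}) = ℚ̄ ⊕ ℚπi`.

What is certified here:

* `crux_of_schanuel`, `schanuel_iff_piFree_and_crux` — the landed exactness
  `Schanuel ⟺ PiFreeOverLWField ∧ C` restated for the SingularModulusScaling copy of the decl
  (the three route copies are syntactically equal: `crux_eq_gaussianStokes`).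
* `engine_local` — the `GL_n(ℚ)` sector engine of `SectorGlue.engine` with the inside count
  supplied PER TUPLE (hypothesis `hI` on `ℚ`-free tuples from `span(x) ⊓ E₂`) instead of the open
  co-crux `PiFreeOverLWField`.
* `schanuel_of_crux_of_avoiding` — **`C` alone gives Schanuel's conclusion for every `ℚ`-free tuple
  whose span meets `E₂` only in algebraic numbers** (inside count = Lindemann–Weierstrass,
  `algebraicIndependent_exp_holds`).
* `realSchanuel_of_crux` — in particular **`C ⟹ Schanuel's conjecture for all tuples of REAL
  numbers** (a real element of `ℚ̄ ⊕ ℚπi` is algebraic: `isAlgebraic_of_mem_span_of_im_eq_zero`,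
  by complex conjugation and the transcendence of `πi`).  Real Schanuel contains the algebraic
  independence of logarithms of positive algebraic numbers (open already for `log 2, log 3`), of
  `e, e^e`, of `e, log 2`, … — so `C` is not "easier than Schanuel" in any sense a known tool sees.
* `crux_rung_free_mod_ecl` — the one PROVED rung of `C`: the count holds for tuples free modulo the
  `ℚ`-span of Kirby's field `ecl(∅)` of exponentially-algebraic numbers (Ax–Kirby,
  `kirby_relative_schanuel_complex_holds`, base change down `K₂ ≤ ℚ(ecl ∅)`).  It sits INSIDE
  Schanuel's known regime (the same theorem gives Schanuel there), so it is not a BC5 witness.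
* `crux_iff_cruxOnEcl` — **`C ⟺ C|ecl(∅)`** (decomposition D2 of the census: the two-sector
  engine `sector_engine` with OUTSIDE count = Kirby's theorem); the only open piece of D2 is the
  crux again, restricted to the countable field where all its named hard instances already live.
* `strengthenedBase_false` — the STRENGTHENING of `C` that enlarges the base to the log–LW field
  `K₃ = ℚ(ℚ̄ ∪ L ∪ e^{ℚ̄})` (keeping freeness modulo `E₂`) is FALSE at `n = 1`, `x = log 2`
  (`transcendental_log_two`, `log_two_not_mem_span`): enlarging the base towards an `ecl`-closed
  field — the only move that would let Ax's theorem bite — breaks the statement before it helps.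

[cite: Kirby2010, Thm. 1.2; BaysKirby2018ANT, §9; Waldschmidt2000, Conj. 1.14–1.15]
-/

noncomputable section

set_option linter.dupNamespace false

namespace Summit.Schanuel.Schanuel.Cruxes.RelSchanuelOverPiLWField.Strategist

open IntermediateField Complex Submodule Set Function
open Algebra (trdeg)
open Summit.Schanuel.Schanuel.Theses
open Summit.Schanuel.Schanuel.Theorems.RigidCore
open Summit.Schanuel.Schanuel.Theorems.RigidCore.SectorGlue
open Literature.NumberTheory.Transcendental

/-! ### 0. The crux and the summit: what is landed -/

/-- The SingularModulusScaling and GaussianStokesSector copies of the crux are the same term. -/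
theorem crux_eq_gaussianStokes :
    SingularModulusScaling.RelSchanuelOverPiLWField =
      GaussianStokesSector.RelSchanuelOverPiLWField := rfl

/-- `S → C` (landed: `SectorExactness.le_trdeg_of_schanuel`, hull count, ~40 lines). -/
theorem crux_of_schanuel (hS : _root_.Schanuel) :
    SingularModulusScaling.RelSchanuelOverPiLWField :=
  fun n x hli => SectorExactness.le_trdeg_of_schanuel hS n x hli

/-- `S ⟺ PiFreeOverLWField ∧ C` (landed: `SectorExactness.schanuel_iff_piFree_and_relSchanuel`):
the crux is the summit MINUS the π-sector `PiFreeOverLWField` (stmt-Schanuel-9545, open). -/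
theorem schanuel_iff_piFree_and_crux :
    _root_.Schanuel ↔ SingularModulusScaling.PiFreeOverLWField ∧
      SingularModulusScaling.RelSchanuelOverPiLWField :=
  SectorExactness.schanuel_iff_piFree_and_relSchanuel

/-! ### 1. The sector engine with a per-tuple inside count -/

/-- **Local sector engine.** If the crux holds and, for the given `ℚ`-free tuple `x`, Schanuel's
count holds for every `ℚ`-free tuple `y` drawn from `span_ℚ(x) ⊓ E₂`, then Schanuel's count holds
at `x`.  (Proof = `SectorGlue.engine` at `C = ⊤` with `inside_count hP` replaced by `hI`.) -/
theorem engine_local (hR : SingularModulusScaling.RelSchanuelOverPiLWField) (n : ℕ)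
    (x : Fin n → ℂ) (hx : LinearIndependent ℚ x)
    (hI : ∀ (k : ℕ) (y : Fin k → ℂ), (∀ i, y i ∈ span ℚ (range x)) →
      (∀ i, y i ∈ span ℚ ({z : ℂ | IsAlgebraic ℚ z} ∪ {(Real.pi : ℂ) * I})) →
      LinearIndependent ℚ y →
      (k : Cardinal) ≤ trdeg ℚ (adjoin ℚ (range y ∪ range (exp ∘ y)))) :
    (n : Cardinal) ≤ trdeg ℚ (adjoin ℚ (range x ∪ range (exp ∘ x))) := by
  have hAC : ∀ {R : Type} [Field R] [Algebra R ℂ] {w : ℂ},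
      w ∈ algebraicClosure R ℂ ↔ IsAlgebraic R w := mem_algebraicClosure_iff
  set E : Submodule ℚ ℂ := span ℚ ({z : ℂ | IsAlgebraic ℚ z} ∪ {(Real.pi : ℂ) * I}) with hE
  set L := adjoin ℚ ({z : ℂ | IsAlgebraic ℚ z} ∪ {(Real.pi : ℂ) * I} ∪
    exp '' {z : ℂ | IsAlgebraic ℚ z})
  set V : Submodule ℚ ℂ := span ℚ (range x) with hV
  haveI : FiniteDimensional ℚ V := FiniteDimensional.span_of_finite ℚ (finite_range x)
  obtain ⟨U', hU'⟩ := (V ⊓ E).exists_isCompl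
  set W : Submodule ℚ ℂ := V ⊓ E
  set U : Submodule ℚ ℂ := V ⊓ U' with hU
  haveI : FiniteDimensional ℚ W := finiteDimensional_of_le inf_le_left
  haveI : FiniteDimensional ℚ U := finiteDimensional_of_le inf_le_left
  have hsup : W ⊔ U = V := by
    rw [hU, inf_comm, ← sup_inf_assoc_of_le U' (inf_le_left : W ≤ V), hU'.sup_eq_top, top_inf_eq]
  have hdj : Disjoint W U := hU'.disjoint.mono_right inf_le_right
  set k := Module.finrank ℚ W
  set m := Module.finrank ℚ U
  have hn : k + m = n := by
    have h1 := finrank_sup_add_finrank_inf_eq W U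
    rw [hdj.eq_bot, finrank_bot, add_zero, hsup, hV, finrank_span_eq_card hx,
      Fintype.card_fin] at h1
    exact h1.symm
  let bW := Module.finBasis ℚ W
  let bU := Module.finBasis ℚ U
  let y : Fin k → ℂ := fun i => bW i
  let z : Fin m → ℂ := fun j => bU j
  have hyli : LinearIndependent ℚ y := bW.linearIndependent.map' W.subtype W.ker_subtype
  have hzli : LinearIndependent ℚ z := bU.linearIndependent.map' U.subtype U.ker_subtype
  have hyE : ∀ i, y i ∈ E := fun i => (bW i).2.2
  have hyV : ∀ i, y i ∈ V := fun i => (bW i).2.1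
  have hzE : LinearIndependent ℚ (E.mkQ ∘ z) := by
    refine hzli.map ?_
    rw [ker_mkQ, disjoint_def]
    intro u hu huE
    have huU : u ∈ U := span_le.2 (range_subset_iff.2 fun j => (bU j).2) hu
    exact disjoint_def.1 hdj u ⟨huU.1, huE⟩ huU
  set Sy := range y ∪ range (exp ∘ y)
  set Sz := range z ∪ range (exp ∘ z)
  set Ky := adjoin ℚ Sy
  set Kx := adjoin ℚ (range x ∪ range (exp ∘ x))
  have hKyL : Ky ≤ L := adjoin_le_iff.2 (by
    rintro _ (⟨i, rfl⟩ | ⟨i, rfl⟩)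
    exacts [(mem_piLW_of_mem_span _ (hyE i)).1, (mem_piLW_of_mem_span _ (hyE i)).2])
  have hVK : ∀ a ∈ V, a ∈ Kx ∧ exp a ∈ algebraicClosure Kx ℂ := by
    intro a ha
    obtain ⟨c, rfl⟩ := (mem_span_range_iff_exists_fun ℚ).1 ha
    refine ⟨sum_mem fun i _ => Kx.toSubalgebra.smul_mem (subset_adjoin ℚ _ (.inl ⟨i, rfl⟩)) _, ?_⟩
    simp_rw [Rat.smul_def]
    rw [exp_sum]
    exact prod_mem fun i _ => exp_rat_mul_mem_algebraicClosure Kx _ _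
      (hAC.2 (isAlgebraic_algebraMap (⟨_, subset_adjoin ℚ _ (.inr ⟨i, rfl⟩)⟩ : Kx)))
  refine (show (n : Cardinal) = k + m by rw [← hn, Nat.cast_add]).trans_le ((add_le_add
    (hI k y hyV hyE hyli) ((hR m z hzE).trans
    (trdeg_adjoin_antitone_base Ky L hKyL Sz ((finite_range z).union (finite_range _))))).trans
    ((trdeg_add_trdeg_adjoin_le ℚ Sy Sz).trans
    (trdeg_adjoin_le_of_subset_algebraicClosure ℚ Kx _ ?_)))
  rintro w ((⟨i, rfl⟩ | ⟨i, rfl⟩) | (⟨j, rfl⟩ | ⟨j, rfl⟩))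
  · exact hAC.2 (isAlgebraic_algebraMap (⟨_, (hVK _ (bW i).2.1).1⟩ : Kx))
  · exact (hVK _ (bW i).2.1).2
  · exact hAC.2 (isAlgebraic_algebraMap (⟨_, (hVK _ (bU j).2.1).1⟩ : Kx))
  · exact (hVK _ (bU j).2.1).2

/-! ### 2. Inside counts that ARE theorems: Lindemann–Weierstrass -/

/-- Lindemann–Weierstrass as an inside count: for `ℚ`-free ALGEBRAIC `y`,
`k ≤ trdeg_ℚ ℚ(y, eʸ)`. [cite: BakerTNT1975, Ch. 1 Thm. 1.4] -/
theorem inside_count_alg (k : ℕ) (y : Fin k → ℂ) (hy : ∀ i, IsAlgebraic ℚ (y i))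
    (hli : LinearIndependent ℚ y) :
    (k : Cardinal) ≤ trdeg ℚ (adjoin ℚ (range y ∪ range (exp ∘ y))) := by
  have h : AlgebraicIndependent ℚ fun i => exp (y i) := algebraicIndependent_exp_holds y hy hli
  have h' : Cardinal.mk (Fin k) ≤ trdeg ℚ (adjoin ℚ (range y ∪ range (exp ∘ y))) :=
    (AlgebraicIndependent.of_comp (adjoin ℚ (range y ∪ range (exp ∘ y))).val
      (x := fun i : Fin k => (⟨exp (y i), subset_adjoin ℚ _ (.inr ⟨i, rfl⟩)⟩ :
        adjoin ℚ (range y ∪ range (exp ∘ y)))) h).cardinalMk_le_trdeg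
  simpa using h'

/-- **`C` ⟹ Schanuel off the `πi`-direction.**  The crux alone gives Schanuel's count
`n ≤ trdeg_ℚ ℚ(x, eˣ)` for every `ℚ`-free tuple `x` such that `span_ℚ(x) ∩ (ℚ̄ ⊕ ℚπi) ⊆ ℚ̄`. -/
theorem schanuel_of_crux_of_avoiding (hR : SingularModulusScaling.RelSchanuelOverPiLWField)
    (n : ℕ) (x : Fin n → ℂ) (hx : LinearIndependent ℚ x)
    (hav : ∀ v ∈ span ℚ (range x),
      v ∈ span ℚ ({z : ℂ | IsAlgebraic ℚ z} ∪ {(Real.pi : ℂ) * I}) → IsAlgebraic ℚ v) :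
    (n : Cardinal) ≤ trdeg ℚ (adjoin ℚ (range x ∪ range (exp ∘ x))) :=
  engine_local hR n x hx fun k y hyV hyE hli =>
    inside_count_alg k y (fun i => hav _ (hyV i) (hyE i)) hli

/-! ### 3. `C` ⟹ Schanuel's conjecture for real numbers -/

/-- A REAL element of `E₂ = ℚ̄ ⊕ ℚπi` is algebraic (write `v = b + qπi`; `v = conj v` forces
`2qπi = conj b − b ∈ ℚ̄`, so `q = 0` by the transcendence of `πi`). -/
theorem isAlgebraic_of_mem_span_of_im_eq_zero {v : ℂ}
    (hv : v ∈ span ℚ ({z : ℂ | IsAlgebraic ℚ z} ∪ {(Real.pi : ℂ) * I})) (him : v.im = 0) :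
    IsAlgebraic ℚ v := by
  obtain ⟨b, hb, q, rfl⟩ := exists_eq_add_rat_mul_pi_I_of_mem_span _ hv
  have hcb : (starRingEnd ℂ) b ∈ algebraicClosure ℚ ℂ :=
    mem_algebraicClosure_iff.2 ((mem_algebraicClosure_iff.1 hb).algHom (starRingEnd ℂ).toRatAlgHom)
  by_cases hq : q = 0
  · rw [hq, Rat.cast_zero, zero_mul, add_zero]; exact mem_algebraicClosure_iff.1 hb
  exfalso
  have hconj := (Complex.conj_eq_iff_im).2 him
  have h1 : (starRingEnd ℂ) (b + q * (Real.pi * I)) = (starRingEnd ℂ) b - q * (Real.pi * I) := by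
    rw [map_add, map_mul, map_mul, map_ratCast, Complex.conj_ofReal, Complex.conj_I]; ring
  rw [h1] at hconj
  have hqc : ((q : ℚ) : ℂ) ≠ 0 := by exact_mod_cast hq
  have h2 : (Real.pi : ℂ) * I = ((starRingEnd ℂ) b - b) * (((2 * q)⁻¹ : ℚ) : ℂ) := by
    rw [Rat.cast_inv, Rat.cast_mul, Rat.cast_ofNat,
      eq_mul_inv_iff_mul_eq₀ (mul_ne_zero two_ne_zero hqc)]
    linear_combination -hconj
  refine transcendental_pi_mul_I ?_
  rw [h2]
  exact mem_algebraicClosure_iff.1 (mul_mem (sub_mem hcb hb) (SubfieldClass.ratCast_mem _ _))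

/-- The `ℚ`-span of real numbers consists of real numbers. -/
theorem im_eq_zero_of_mem_span {n : ℕ} {x : Fin n → ℂ} (hx : ∀ i, (x i).im = 0) {v : ℂ}
    (hv : v ∈ span ℚ (range x)) : v.im = 0 := by
  induction hv using Submodule.span_induction with
  | mem u hu => obtain ⟨i, rfl⟩ := hu; exact hx i
  | zero => simp
  | add u w _ _ hu hw => rw [add_im, hu, hw, add_zero]
  | smul q u _ hu => rw [Rat.smul_def, mul_im, hu]; simp

/-- **`C` ⟹ Schanuel's conjecture for every tuple of REAL numbers**: if `x₁, …, xₙ ∈ ℝ` are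
`ℚ`-linearly independent then `trdeg_ℚ ℚ(x, eˣ) ≥ n`.  (Real Schanuel contains the algebraic
independence of the logarithms of multiplicatively independent positive algebraic numbers, of
`{e, e^e}`, `{e, log 2}`, `{π, e^{π²}}` …, none of which any known method reaches.) -/
theorem realSchanuel_of_crux (hR : SingularModulusScaling.RelSchanuelOverPiLWField) :
    ∀ (n : ℕ) (x : Fin n → ℂ), (∀ i, (x i).im = 0) → LinearIndependent ℚ x →
      (n : Cardinal) ≤ trdeg ℚ (adjoin ℚ (range x ∪ range (exp ∘ x))) :=
  fun n x hreal hx => schanuel_of_crux_of_avoiding hR n x hx fun _ hv hvE =>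
    isAlgebraic_of_mem_span_of_im_eq_zero hvE (im_eq_zero_of_mem_span hreal hv)

/-- Packaged: the crux implies "real Schanuel" stated over `ℝ`-valued tuples coerced to `ℂ`. -/
theorem realSchanuel_of_crux' (hR : SingularModulusScaling.RelSchanuelOverPiLWField)
    (n : ℕ) (x : Fin n → ℝ) (hx : LinearIndependent ℚ (fun i => (x i : ℂ))) :
    (n : Cardinal) ≤ trdeg ℚ (adjoin ℚ (range (fun i => (x i : ℂ)) ∪
      range (exp ∘ fun i => (x i : ℂ)))) :=
  realSchanuel_of_crux hR n _ (fun i => ofReal_im (x i)) hx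

/-! ### 4. The proved rung: tuples free modulo Kirby's `ecl(∅)` (Ax–Kirby) -/

/-- The π–LW field sits inside the field generated by `ecl(∅)`. -/
theorem piLW_le_adjoin_ecl :
    adjoin ℚ ({z : ℂ | IsAlgebraic ℚ z} ∪ {(Real.pi : ℂ) * I} ∪ exp '' {z : ℂ | IsAlgebraic ℚ z}) ≤
      adjoin ℚ (ecl (∅ : Set ℂ)) := by
  refine adjoin.mono ℚ _ _ ?_
  rintro w ((hw | hw) | ⟨a, ha, rfl⟩)
  · exact isExpAlgebraic_iff_mem_ecl_empty.1 (IsExpAlgebraic.of_isAlgebraic hw)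
  · rw [mem_singleton_iff.1 hw]; exact isExpAlgebraic_iff_mem_ecl_empty.1 isExpAlgebraic_pi_mul_I
  · exact isExpAlgebraic_iff_mem_ecl_empty.1 (IsExpAlgebraic.of_isAlgebraic ha).exp

/-- **Proved rung of the crux (generic fibre).**  For tuples `ℚ`-free modulo the `ℚ`-span of
`ecl(∅)` (a stronger freeness than modulo `E₂ ⊆ ecl ∅`), the crux's count holds: Kirby's relative
Schanuel theorem over `ecl(∅)` (`kirby_relative_schanuel_complex_holds`, from Ax 1971) and base
change down to `K₂ ≤ ℚ(ecl ∅)`. [cite: Kirby2010, Thm. 1.2] -/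
theorem crux_rung_free_mod_ecl (n : ℕ) (x : Fin n → ℂ)
    (hx : LinearIndependent ℚ ((span ℚ (ecl (∅ : Set ℂ))).mkQ ∘ x)) :
    (n : Cardinal) ≤ trdeg
      ↥(adjoin ℚ ({z : ℂ | IsAlgebraic ℚ z} ∪ {(Real.pi : ℂ) * I} ∪ exp '' {z : ℂ | IsAlgebraic ℚ z}))
      ↥(adjoin ↥(adjoin ℚ ({z : ℂ | IsAlgebraic ℚ z} ∪ {(Real.pi : ℂ) * I} ∪
          exp '' {z : ℂ | IsAlgebraic ℚ z})) (range x ∪ range (exp ∘ x))) :=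
  (kirby_relative_schanuel_complex_holds n x hx).trans
    (trdeg_adjoin_antitone_base _ _ piLW_le_adjoin_ecl _
      ((finite_range x).union (finite_range _)))

/-- The rung in the crux's own binder shape: freeness modulo `span(ecl ∅)` implies freeness
modulo `E₂` is NOT needed — the rung's hypothesis is the stronger one, so this is the crux
RESTRICTED to the generic fibre, verbatim conclusion. -/
theorem crux_on_generic_fibre :
    ∀ (n : ℕ) (x : Fin n → ℂ), LinearIndependent ℚ ((span ℚ (ecl (∅ : Set ℂ))).mkQ ∘ x) →
      (n : Cardinal) ≤ Algebra.trdeg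
        ↥(IntermediateField.adjoin ℚ ({z : ℂ | IsAlgebraic ℚ z} ∪ {(Real.pi : ℂ) * Complex.I} ∪
          Complex.exp '' {z : ℂ | IsAlgebraic ℚ z}))
        ↥(IntermediateField.adjoin ↥(IntermediateField.adjoin ℚ ({z : ℂ | IsAlgebraic ℚ z} ∪
          {(Real.pi : ℂ) * Complex.I} ∪ Complex.exp '' {z : ℂ | IsAlgebraic ℚ z}))
          (Set.range x ∪ Set.range (Complex.exp ∘ x))) :=
  crux_rung_free_mod_ecl

/-! ### 5. The crux lives on Kirby's countable field: `C ⟺ C|ecl(∅)` (decomposition D2) -/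

/-- Base change DOWN across different scalar fields (verbatim copy of
`Cruxes/RelSchanuelOverPiLWField/Lines/birth.lean :: trdeg_adjoin_antitone_base'`, which is not an
importable module). [folklore] -/
theorem trdeg_adjoin_antitone_base' {K K' : Type} [Field K] [Field K'] [Algebra K ℂ]
    [Algebra K' ℂ] (F₁ : IntermediateField K ℂ) (F₂ : IntermediateField K' ℂ)
    (h12 : ∀ w : ℂ, w ∈ F₁ → w ∈ F₂) (S : Set ℂ) (hS : S.Finite) :
    trdeg F₂ (adjoin F₂ S) ≤ trdeg F₁ (adjoin F₁ S) := by
  obtain ⟨t, ht⟩ := (AlgebraicIndependent.matroid F₂ ℂ).exists_isBasis S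
  obtain ⟨hti, hts, hta⟩ := AlgebraicIndependent.matroid_isBasis_iff.1 ht
  have htf := hS.subset hts
  have hle : adjoin F₂ S ≤ (algebraicClosure (adjoin F₂ t) ℂ).restrictScalars F₂ :=
    adjoin_le_iff.2 fun w hw => mem_algebraicClosure_iff.2 (isAlgebraic_adjoin_iff.2 (hta w hw))
  let φ : F₁ →+* F₂ :=
    { toFun := fun w => ⟨(w : ℂ), h12 _ w.2⟩
      map_one' := rfl
      map_mul' := fun _ _ => rfl
      map_zero' := rfl
      map_add' := fun _ _ => rfl }
  letI : Algebra F₁ F₂ := φ.toAlgebra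
  haveI : IsScalarTower F₁ F₂ ℂ := .of_algebraMap_eq fun _ => rfl
  have hφ : Function.Injective (algebraMap F₁ F₂) := fun a b h =>
    Subtype.ext (congrArg Subtype.val h :)
  calc trdeg F₂ (adjoin F₂ S) ≤ htf.toFinset.card :=
        Literature.FieldTheory.TranscendenceDegree.trdeg_le_card_of_forall_isAlgebraic
          (adjoin F₂ S).toSubalgebra htf.toFinset
          fun w hw => by
            rw [htf.coe_toFinset, ← isAlgebraic_adjoin_iff]
            exact mem_algebraicClosure_iff.1 (hle hw)
    _ = Cardinal.mk t := by rw [← ncard_eq_toFinset_card t htf, cast_ncard htf]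
    _ ≤ _ := (AlgebraicIndependent.of_comp (adjoin F₁ S).val
        (x := fun i : t => (⟨i, subset_adjoin F₁ S (hts i.2)⟩ : adjoin F₁ S))
        (hti.restrictScalars hφ)).cardinalMk_le_trdeg

/-- Freeness modulo a subspace `N` makes `span_ℚ(x)` disjoint from `N` (copy of `birth.lean ::
disjoint_span_of_free`). [folklore] -/
theorem disjoint_span_of_free {n : ℕ} {x : Fin n → ℂ} (N : Submodule ℚ ℂ)
    (hx : LinearIndependent ℚ (N.mkQ ∘ x)) : Disjoint (span ℚ (range x)) N := by
  rw [disjoint_def]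
  intro u hu huN
  obtain ⟨c, rfl⟩ := (mem_span_range_iff_exists_fun ℚ).1 hu
  have h0 : ∑ i, c i • (N.mkQ ∘ x) i = 0 := by
    have h1 : N.mkQ (∑ i, c i • x i) = 0 := (Submodule.Quotient.mk_eq_zero N).2 huN
    simpa [map_sum, map_smul] using h1
  have hc : ∀ i, c i = 0 := fun i => Fintype.linearIndependent_iff.1 hx c h0 i
  simp [hc]

/-- **Generic two-sector engine** (copy of `birth.lean :: sector_engine`): bottom field `K ≤ K'`,
sectors `E ⊆ E'` with `E', e^{E'} ⊆ K'`; INSIDE (tuples from `E'` free mod `E`, counted over `K`)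
and OUTSIDE (tuples free mod `E'`, counted over `K'`) give the count over `K` for every tuple free
modulo `E`. [folklore] -/
theorem sector_engine (K K' : IntermediateField ℚ ℂ) (E E' : Submodule ℚ ℂ) (hKK' : K ≤ K')
    (hE'K' : ∀ a ∈ E', a ∈ K' ∧ exp a ∈ K')
    (hIn : ∀ (k : ℕ) (y : Fin k → ℂ), (∀ i, y i ∈ E') → LinearIndependent ℚ (E.mkQ ∘ y) →
      (k : Cardinal) ≤ trdeg K (adjoin K (range y ∪ range (exp ∘ y))))
    (hOut : ∀ (m : ℕ) (z : Fin m → ℂ), LinearIndependent ℚ (E'.mkQ ∘ z) →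
      (m : Cardinal) ≤ trdeg K' (adjoin K' (range z ∪ range (exp ∘ z)))) :
    ∀ (n : ℕ) (x : Fin n → ℂ), LinearIndependent ℚ (E.mkQ ∘ x) →
      (n : Cardinal) ≤ trdeg K (adjoin K (range x ∪ range (exp ∘ x))) := by
  intro n x hx
  have hAC : ∀ {R : Type} [Field R] [Algebra R ℂ] {w : ℂ},
      w ∈ algebraicClosure R ℂ ↔ IsAlgebraic R w := mem_algebraicClosure_iff
  have hxli : LinearIndependent ℚ x := LinearIndependent.of_comp _ hx
  set V : Submodule ℚ ℂ := span ℚ (range x) with hV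
  haveI : FiniteDimensional ℚ V := FiniteDimensional.span_of_finite ℚ (finite_range x)
  obtain ⟨U', hU'⟩ := (V ⊓ E').exists_isCompl
  set W : Submodule ℚ ℂ := V ⊓ E'
  set U : Submodule ℚ ℂ := V ⊓ U' with hU
  haveI : FiniteDimensional ℚ W := finiteDimensional_of_le inf_le_left
  haveI : FiniteDimensional ℚ U := finiteDimensional_of_le inf_le_left
  have hsup : W ⊔ U = V := by
    rw [hU, inf_comm, ← sup_inf_assoc_of_le U' (inf_le_left : W ≤ V), hU'.sup_eq_top, top_inf_eq]
  have hdj : Disjoint W U := hU'.disjoint.mono_right inf_le_right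
  set k := Module.finrank ℚ W
  set m := Module.finrank ℚ U
  have hn : k + m = n := by
    have h1 := finrank_sup_add_finrank_inf_eq W U
    rw [hdj.eq_bot, finrank_bot, add_zero, hsup, hV, finrank_span_eq_card hxli,
      Fintype.card_fin] at h1
    exact h1.symm
  let bW := Module.finBasis ℚ W
  let bU := Module.finBasis ℚ U
  let y : Fin k → ℂ := fun i => bW i
  let z : Fin m → ℂ := fun j => bU j
  have hyli : LinearIndependent ℚ y := bW.linearIndependent.map' W.subtype W.ker_subtype
  have hzli : LinearIndependent ℚ z := bU.linearIndependent.map' U.subtype U.ker_subtype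
  have hyE' : ∀ i, y i ∈ E' := fun i => (bW i).2.2
  have hyfree : LinearIndependent ℚ (E.mkQ ∘ y) := by
    refine hyli.map ?_
    rw [ker_mkQ]
    exact (disjoint_span_of_free _ hx).mono_left
      (span_le.2 (range_subset_iff.2 fun i => (bW i).2.1))
  have hzE' : LinearIndependent ℚ (E'.mkQ ∘ z) := by
    refine hzli.map ?_
    rw [ker_mkQ, disjoint_def]
    intro u hu huE
    have huU : u ∈ U := span_le.2 (range_subset_iff.2 fun j => (bU j).2) hu
    exact disjoint_def.1 hdj u ⟨huU.1, huE⟩ huU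
  set Sy := range y ∪ range (exp ∘ y)
  set Sz := range z ∪ range (exp ∘ z)
  set Ky := adjoin K Sy
  set Kx := adjoin K (range x ∪ range (exp ∘ x))
  have hKyK' : ∀ w : ℂ, w ∈ Ky → w ∈ K' := by
    intro w hw
    have hle : Ky ≤ IntermediateField.extendScalars hKK' := adjoin_le_iff.2 (by
      rintro _ (⟨i, rfl⟩ | ⟨i, rfl⟩)
      · exact (hE'K' _ (hyE' i)).1
      · exact (hE'K' _ (hyE' i)).2)
    exact (IntermediateField.mem_extendScalars hKK').1 (hle hw)
  have hVK : ∀ a ∈ V, a ∈ Kx ∧ exp a ∈ algebraicClosure Kx ℂ := by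
    intro a ha
    obtain ⟨c, rfl⟩ := (mem_span_range_iff_exists_fun ℚ).1 ha
    refine ⟨sum_mem fun i _ => ?_, ?_⟩
    · rw [Rat.smul_def]
      exact mul_mem (SubfieldClass.ratCast_mem Kx _) (subset_adjoin K _ (.inl ⟨i, rfl⟩))
    · simp_rw [Rat.smul_def]
      rw [exp_sum]
      exact prod_mem fun i _ => exp_rat_mul_mem_algebraicClosure Kx _ _
        (hAC.2 (isAlgebraic_algebraMap (⟨_, subset_adjoin K _ (.inr ⟨i, rfl⟩)⟩ : Kx)))
  refine (show (n : Cardinal) = k + m by rw [← hn, Nat.cast_add]).trans_le ((add_le_add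
    (hIn k y hyE' hyfree) ((hOut m z hzE').trans
    (trdeg_adjoin_antitone_base' Ky K' hKyK' Sz ((finite_range z).union (finite_range _))))).trans
    ((trdeg_add_trdeg_adjoin_le K Sy Sz).trans
    (trdeg_adjoin_le_of_subset_algebraicClosure K Kx _ ?_)))
  rintro w ((⟨i, rfl⟩ | ⟨i, rfl⟩) | (⟨j, rfl⟩ | ⟨j, rfl⟩))
  · exact hAC.2 (isAlgebraic_algebraMap (⟨_, (hVK _ (bW i).2.1).1⟩ : Kx))
  · exact (hVK _ (bW i).2.1).2
  · exact hAC.2 (isAlgebraic_algebraMap (⟨_, (hVK _ (bU j).2.1).1⟩ : Kx))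
  · exact (hVK _ (bU j).2.1).2

/-- The `ℚ`-span of `ecl(∅)` is `ecl(∅)` (a subfield containing `ℚ`). -/
theorem mem_ecl_of_mem_span {a : ℂ} (ha : a ∈ span ℚ (ecl (∅ : Set ℂ))) :
    a ∈ ecl (∅ : Set ℂ) := by
  induction ha using Submodule.span_induction with
  | mem u hu => exact hu
  | zero => simpa using isExpAlgebraic_iff_mem_ecl_empty.1 (isExpAlgebraic_ratCast 0)
  | add u w _ _ hu hw =>
    exact isExpAlgebraic_iff_mem_ecl_empty.1
      ((isExpAlgebraic_iff_mem_ecl_empty.2 hu).add (isExpAlgebraic_iff_mem_ecl_empty.2 hw))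
  | smul q u _ hu =>
    rw [Rat.smul_def]
    exact isExpAlgebraic_iff_mem_ecl_empty.1
      ((isExpAlgebraic_ratCast q).mul (isExpAlgebraic_iff_mem_ecl_empty.2 hu))

/-- **`C|ecl(∅)`** — the crux restricted to tuples from the `ℚ`-span of Kirby's countable field
`ecl(∅)` of exponentially-algebraic numbers (same freeness, same base `K₂`, same conclusion). -/
def CruxOnEcl : Prop :=
  ∀ (k : ℕ) (y : Fin k → ℂ), (∀ i, y i ∈ span ℚ (ecl (∅ : Set ℂ))) →
    LinearIndependent ℚ ((span ℚ ({z : ℂ | IsAlgebraic ℚ z} ∪ {(Real.pi : ℂ) * I})).mkQ ∘ y) →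
    (k : Cardinal) ≤ trdeg
      ↥(adjoin ℚ ({z : ℂ | IsAlgebraic ℚ z} ∪ {(Real.pi : ℂ) * I} ∪ exp '' {z : ℂ | IsAlgebraic ℚ z}))
      ↥(adjoin ↥(adjoin ℚ ({z : ℂ | IsAlgebraic ℚ z} ∪ {(Real.pi : ℂ) * I} ∪
          exp '' {z : ℂ | IsAlgebraic ℚ z})) (range y ∪ range (exp ∘ y)))

/-- **`C ⟺ C|ecl(∅)`**: the essential content of the crux lies in the countable field `ecl(∅)`
(`⟸`: two-sector engine with outer sector `span(ecl ∅)`, outer base `ℚ(ecl ∅)`, OUTSIDE count =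
Kirby's theorem `kirby_relative_schanuel_complex_holds`; `⟹`: restriction).  This is the crux-level
copy of the Literature fact `schanuelConjecture_iff_ecl_empty_holds` (Kirby 2010, Prop. 7.2) — a
known reduction, recorded here to show that decomposition D2 (`C ⇐ C|ecl(∅) ∧ Ax–Kirby`) has one
open piece which is the crux again. [cite: Kirby2010, Thm. 1.2 and Prop. 7.2] -/
theorem crux_iff_cruxOnEcl : SingularModulusScaling.RelSchanuelOverPiLWField ↔ CruxOnEcl := by
  refine ⟨fun h k y _ hy => h k y hy, fun h => ?_⟩
  have hE'K' : ∀ a ∈ span ℚ (ecl (∅ : Set ℂ)),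
      a ∈ adjoin ℚ (ecl (∅ : Set ℂ)) ∧ exp a ∈ adjoin ℚ (ecl (∅ : Set ℂ)) := fun a ha =>
    ⟨subset_adjoin ℚ _ (mem_ecl_of_mem_span ha),
      subset_adjoin ℚ _ (isExpAlgebraic_iff_mem_ecl_empty.1
        (isExpAlgebraic_iff_mem_ecl_empty.2 (mem_ecl_of_mem_span ha)).exp)⟩
  exact sector_engine _ (adjoin ℚ (ecl (∅ : Set ℂ))) _ (span ℚ (ecl (∅ : Set ℂ)))
    piLW_le_adjoin_ecl hE'K' h kirby_relative_schanuel_complex_holds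

/-! ### 6. Strengthening the base kills the statement at `n = 1` (`x = log 2`) -/

/-- `log 2` is transcendental (Hermite–Lindemann: else `2 = e^{log 2}` would be transcendental).
[cite: BakerTNT1975, Ch. 1 Thm. 1.4] -/
theorem transcendental_log_two : Transcendental ℚ (Real.log 2 : ℂ) := by
  intro halg
  have hne : (Real.log 2 : ℂ) ≠ 0 := by exact_mod_cast (Real.log_pos one_lt_two).ne'
  refine transcendental_exp_holds halg hne ?_
  rw [← ofReal_exp, Real.exp_log two_pos]
  exact_mod_cast isAlgebraic_nat (R := ℚ) (A := ℂ) 2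

/-- `log 2 ∉ E₂ = ℚ̄ ⊕ ℚπi` (it is real and transcendental). -/
theorem log_two_not_mem_span :
    (Real.log 2 : ℂ) ∉ span ℚ ({z : ℂ | IsAlgebraic ℚ z} ∪ {(Real.pi : ℂ) * I}) := fun h =>
  transcendental_log_two (isAlgebraic_of_mem_span_of_im_eq_zero h (ofReal_im _))

/-- **S⁺ (bigger base) is FALSE.**  Keeping the crux's freeness hypothesis (modulo `E₂`) but
counting over the log–LW field `K₃ = ℚ(ℚ̄ ∪ L ∪ e^{ℚ̄}) ⊇ K₂`, `L = {z | e^z ∈ ℚ̄}` (the base of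
the birth skeleton's stub 2, which correctly strengthens the FREENESS to modulo `ℚ̄ ⊕ L` as well),
fails at `n = 1`, `x = log 2`: `log 2` is free modulo `E₂` but `log 2, e^{log 2} = 2 ∈ K₃`. -/
theorem strengthenedBase_false :
    ¬ ∀ (n : ℕ) (x : Fin n → ℂ),
      LinearIndependent ℚ ((span ℚ ({z : ℂ | IsAlgebraic ℚ z} ∪ {(Real.pi : ℂ) * I})).mkQ ∘ x) →
      (n : Cardinal) ≤ trdeg
        ↥(adjoin ℚ ({z : ℂ | IsAlgebraic ℚ z} ∪ {z : ℂ | IsAlgebraic ℚ (exp z)} ∪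
          exp '' {z : ℂ | IsAlgebraic ℚ z}))
        ↥(adjoin ↥(adjoin ℚ ({z : ℂ | IsAlgebraic ℚ z} ∪ {z : ℂ | IsAlgebraic ℚ (exp z)} ∪
          exp '' {z : ℂ | IsAlgebraic ℚ z})) (range x ∪ range (exp ∘ x))) := by
  intro h
  set K₃ := adjoin ℚ ({z : ℂ | IsAlgebraic ℚ z} ∪ {z : ℂ | IsAlgebraic ℚ (exp z)} ∪
    exp '' {z : ℂ | IsAlgebraic ℚ z}) with hK₃
  have hexp : exp (Real.log 2 : ℂ) = 2 := by rw [← ofReal_exp, Real.exp_log two_pos]; norm_num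
  have h2alg : IsAlgebraic ℚ (2 : ℂ) := by exact_mod_cast isAlgebraic_nat (R := ℚ) (A := ℂ) 2
  have hlog : (Real.log 2 : ℂ) ∈ K₃ :=
    subset_adjoin ℚ _ (.inl (.inr (show IsAlgebraic ℚ (exp (Real.log 2 : ℂ)) by rwa [hexp])))
  have htwo : (2 : ℂ) ∈ K₃ := subset_adjoin ℚ _ (.inl (.inl h2alg))
  have hfree : LinearIndependent ℚ
      ((span ℚ ({z : ℂ | IsAlgebraic ℚ z} ∪ {(Real.pi : ℂ) * I})).mkQ ∘ fun _ : Fin 1 =>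
        (Real.log 2 : ℂ)) :=
    linearIndependent_unique_iff.2 (by
      simpa [Submodule.Quotient.mk_eq_zero] using log_two_not_mem_span)
  have h1 := h 1 (fun _ => (Real.log 2 : ℂ)) hfree
  have halg : Algebra.IsAlgebraic K₃
      (adjoin K₃ (range (fun _ : Fin 1 => (Real.log 2 : ℂ)) ∪
        range (exp ∘ fun _ : Fin 1 => (Real.log 2 : ℂ)))) := by
    refine IntermediateField.isAlgebraic_adjoin fun w hw => ?_
    have hwK : w ∈ K₃ := by
      rcases hw with ⟨_, rfl⟩ | ⟨_, rfl⟩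
      · exact hlog
      · show exp (Real.log 2 : ℂ) ∈ K₃
        rw [hexp]; exact htwo
    exact (isIntegral_algebraMap (x := (⟨w, hwK⟩ : K₃)))
  rw [trdeg_eq_zero] at h1
  exact absurd h1 (by norm_num)

end Summit.Schanuel.Schanuel.Cruxes.RelSchanuelOverPiLWField.Strategist

end
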